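import Summits.QuantumFields.BalabanUV.Beta.D1BFx.GluonLegTails
import Summits.QuantumFields.BalabanUV.Beta.D1BFx.GluonLegBlockMass
import Summits.QuantumFields.BalabanUV.Beta.D1BFx.LatticeHLSProfiles

/-!
# `BalabanUV.Beta.D1BFx.GluonLegProfileD1` — road «BF-x» for binder row D1, slot (K), END row `hGrp gN`, letter (L1) — THE d1 ROW: THE GLUON LEG's FIRST
# DIFFERENCES HAVE THE DAMPED `r⁻³` PROFILE AT EVERY PAIR («GN-L1-PROFILE-D1») AND THE BLOCK-ROW MASS `O(n)·e^{−δ′·dist}` («GN-L1-MASS-D1»), modulo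
# [B5, Prop. 1.2] ∧ [B5, (1.126)–(1.127)] BY NAME — with the colour index `l` FREE (every component pair `(κ, l)`)

HONEST DEPENDENCY (cell records, verbatim): «continuum YM on T⁴ ⇐ BetaPertH ∧ nine spine estimates (0/9 proved); BetaPertH ⇐ (D1) ∧ (D4) ∧
CAP+tail; G-an2-4 gates asym, D1 and NE2/3/4.»  HONEST FRAMING (cell contract, verbatim): «discharging `BetaPertH` makes Bałaban's UV stability
UNCONDITIONAL — a real constructive-QFT result; it is NOT the continuum limit and NOT the Clay problem.»  THIS MODULE DISCHARGES NOTHING of the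
wall: §1 is the entrywise-limit bookkeeping of leaf-03's `FrozenLegTails.Kinf_rows_of_prop12` VERBATIM with the second colour index set free
(an5's `VectorTailsPt.legs_pt_A` clause (A 1) is stated for every component pair; `Kinf_rows_of_prop12` instantiated it on the diagonal `l = κ` only —
an3-g57 §3′ (2): «the off-diagonal d1 tail is the same instantiation of `legs_pt_A` (A 1) with `l` free»), §2 the two-case profile packaging (diagonal
from leaf-04-g8's hypothesis-free `LocalTadpoleRows.abs_Ga_le_flatEntry`), §3 the block mass by leaf-04-g9's HLS kit
(`LatticeHLSRadial.sum_exp_div_nrm_pow_le`, p = 3).  No `def`, no `def … : Prop`, nothing cited, 0 sorry; the printed statements enter as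
HYPOTHESES `h12`∕`h126` by name, never as facts.  Root-level binders hW ∕ hR-sockets ∕ hSX-socket ∕ D1Tel ∕ D1Rep — 0 discharged; (K) NOT closed;
NOT D1, NOT `BetaPertH`, NOT continuum, NOT Clay.

WHY (owner RULING ρ-g10-3, journal 2026-08-21 ≈l.30420: «GN-L1-PROFILE-D1 ∕ GN-L1-MASS-D1 GO as well: the `dip ⊗ ·` and `ndl ⊗ ·` cells of T₃ and the
(K)∕(Q̇) pieces of T₁∕T₂ need the d1 profile `|Ga(b,κ; b+w+e_ρ,l) − Ga(b,κ; b+w,l)| ≤ A₁e^{−(δ∕n)‖w‖}∕nrm(w)³` … and its block-mass `O(n)` corollary»;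
an3-g57 §3′ (2) «d1 `A₁·e^{−(δ∕n)‖w‖}∕‖w‖³` … ⇒ fine masses `Σ_{x′}|∇Ga(x,x′)| ≤ k·n`»).  These are the `a = 3` inputs `|A x y c e| ≤ κ∕nrm(x−y)³` of
`LatticeHLSPairing.abs_applyK_le_of_profiles` ∕ `LatticeHLSProfiles.abs_(t)sum_mul_le_of_profiles` and the `O(n)` block mass the row files weigh
against block-structured partners.

CONTENT.
* §1 [folklore] **`Kinf_d1_row_of_prop12`** — `∃ δ A₁, ∀ n b w κ l, w ≠ 0 → ∀ ρ, |K^∞((b,κ),(b+w+e_ρ,l)) − K^∞((b,κ),(b+w,l))| ≤ A₁e^{−(δ∕n)‖w‖∞}∕‖w‖∞³`.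
* §2 [folklore] **`exists_abs_Ga_diff_le_profile`** (`|Ga n a x (y+e_ρ) κ l − Ga n a x y κ l| ≤ kG′·e^{−(δ∕n)‖y−x‖∞}∕nrm(y−x)³` at EVERY pair,
  `kG′ = A₁ + 2A_d`), `exists_abs_Ga_diff_left_le_profile` (the difference on the first site, by `Ga_symm`), undamped `exists_abs_Ga_diff_le_inv_cube`
  (the kit's `hA` shape, `a = 3`, `nrm(x−y)`).
* §3 [folklore] **`exists_sum_B_abs_Ga_diff_le`** — (L1)-MASS-D1: `∃ C δ′, Σ_{t ∈ B (n−1) β} |Ga n a y (t+e_ρ) κ l − Ga n a y t κ l| ≤ C·n·e^{−δ′·dist (blk (n−1) y) β}`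
  (half the rate for the block decay via `dist_blk_ge`, the other half summed by the kit at `p = 3`: `Σ e^{−(δ∕2n)‖·‖}∕nrm³ ≤ 1 + 216(1 + 4n∕δ)`).
Unit `b2b-balaban-beta-d1-formalise-leaf-04` (gen 9); `LEAVES-BFx.md` row (N) «GN-L1-PROFILE-D1» ∕ «GN-L1-MASS-D1».
-/

noncomputable section

namespace Summit.QuantumFields.BalabanUV.Beta.D1BFx.GluonLegProfileD1

open Filter Topology Finset
open Literature.MathematicalPhysics.QuantumFieldTheory.Balaban1983to89
open Literature.MathematicalPhysics.QuantumFieldTheory.Balaban1983to89.Beta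
open B5Prop11Plancherel (calG fine Tor)
open B6QGQLower276 (X blk B mem_B)
open B6QGQDecay237 (dist_blk_ge)
open DyadicShell (Pt)
open BubbleTransfer (unitVec)
open VectorTails (castT castT_add)
open VectorTailsPt (rd rdM InBox legs_pt_A eventually_inBox abs_re_le)
open VectorTailsLoc (fam kfam)
open VectorPropagatorLimit (Kinf calG_re_tendsto_Kinf Kinf_symm)
open BlockKernelVolumeSockets (evenPeriod)
open FreeLegDictionary (cubic)
open PoissonInterior (nrm nrm_pos one_le_nrm nrm_neg supNorm_zero supNorm_neg)
open Summit.QuantumFields.BalabanUV.Beta.D1BFx.GluonLeg (Ga Ga_apply Ga_symm)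
open Summit.QuantumFields.BalabanUV.Beta.D1BFx.LocalTadpoleRows (abs_Ga_le_flatEntry)
open Summit.QuantumFields.BalabanUV.Beta.D1BFx.FrozenLegTails (nOf MOf hn1 sides_tendsto)
open Summit.QuantumFields.BalabanUV.Beta.D1BFx.GhostLegBlockMass (dist_eq_supNorm)
open Summit.QuantumFields.BalabanUV.Beta.D1BFx.PointColumnSplit (cG0)
open Summit.QuantumFields.BalabanUV.Beta.D1BFx.LatticeHLSProfiles (supNorm_dyadic nrm_eq_supNorm_of_ne_zero)
open Summit.QuantumFields.BalabanUV.Beta.D1BFx.LatticeHLSRadial (nrm_eq_max sum_exp_div_nrm_pow_le)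
open LongitudinalWindow (ellD0)
open WoodburyCovariant (woodburyDc)

variable (a : ℝ) (ha : 0 < a)

/-! ## §1 The d1 tail of every entry of `K^∞`, colour index free -/

/-- [folklore] **THE d1 ROW OF EVERY ENTRY OF `K^∞`, MODULO [B5, Prop. 1.2] ∧ [B5, (1.126)–(1.127)] BY NAME**: one rate `δ > 0` and one constant
`A₁ ≥ 0` with `|K^∞((b,κ),(b+w+e_ρ,l)) − K^∞((b,κ),(b+w,l))| ≤ A₁e^{−(δ∕n)‖w‖∞}∕‖w‖∞³` for every `n ≥ 1`, `b`, `w ≠ 0`, `κ`, `l`, `ρ` (an5's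
`legs_pt_A` clause (A 1) for the reading `n²·Re 𝒢_T((x₀+v,l),(x₀,κ))` on every torus of the family, the entrywise limit `calG_re_tendsto_Kinf`,
and `Kinf_symm` — the proof of `FrozenLegTails.Kinf_rows_of_prop12` with the second colour index free). -/
theorem Kinf_d1_row_of_prop12 (h12 : B5.Prop12Printed (fam nOf hn1 MOf a ha)) (h126 : B5.Kernel126_127Printed (kfam nOf MOf)) :
    ∃ δ A₁ : ℝ, 0 < δ ∧ 0 ≤ A₁ ∧ ∀ (n : ℕ) [NeZero n] (b w : Pt) (κ l : Fin 4), w ≠ 0 → ∀ ρ : Fin 4,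
      |Kinf n a (b, κ) (b + w + unitVec ρ, l) - Kinf n a (b, κ) (b + w, l)| ≤
        A₁ * Real.exp (-(δ / n) * DyadicShell.supNorm w) / (DyadicShell.supNorm w : ℝ) ^ 3 := by
  obtain ⟨δ, A, hδ, hA, h⟩ := legs_pt_A nOf hn1 MOf a ha h12 h126
  refine ⟨δ, A 1, hδ, hA 1, fun n _ b w κ l hw ρ => ?_⟩
  have hn : 1 ≤ n := Nat.one_le_iff_ne_zero.mpr (NeZero.ne n)
  have hbox : ∀ᶠ t : ℕ in atTop, InBox (fine n (cubic 4 (evenPeriod t))) w :=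
    eventually_inBox nOf MOf (l := atTop) (fun t : ℕ => ((⟨n, hn⟩ : ℕ+), t)) (sides_tendsto ⟨n, hn⟩) w
  have key : ∀ t : ℕ, InBox (fine n (cubic 4 (evenPeriod t))) w →
      |rd n hn (cubic 4 (evenPeriod t)) a ha (castT _ b) l κ Complex.reAddGroupHom (w + unitVec ρ) -
          rd n hn (cubic 4 (evenPeriod t)) a ha (castT _ b) l κ Complex.reAddGroupHom w| ≤
        A 1 * Real.exp (-(δ / n) * DyadicShell.supNorm w) / (DyadicShell.supNorm w : ℝ) ^ 3 := fun t ht =>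
    (h ((⟨n, hn⟩ : ℕ+), t) (castT _ b) l κ Complex.reAddGroupHom abs_re_le w hw ht).2.1 ρ
  have erd : ∀ (t : ℕ) (v : Pt), rd n hn (cubic 4 (evenPeriod t)) a ha (castT _ b) l κ Complex.reAddGroupHom v =
      ((n : ℕ) : ℝ) ^ 2 * (calG n hn (cubic 4 (evenPeriod t)) a ha (castT (fine n (cubic 4 (evenPeriod t))) (b + v), l)
        (castT (fine n (cubic 4 (evenPeriod t))) b, κ)).re := by
    intro t v
    simp only [rd, rdM, VectorLegVolumeAdapter.re_apply, castT_add]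
  have lim1 : Tendsto (fun t => rd n hn (cubic 4 (evenPeriod t)) a ha (castT _ b) l κ Complex.reAddGroupHom (w + unitVec ρ) -
      rd n hn (cubic 4 (evenPeriod t)) a ha (castT _ b) l κ Complex.reAddGroupHom w) atTop
      (𝓝 (Kinf n a (b + w + unitVec ρ, l) (b, κ) - Kinf n a (b + w, l) (b, κ))) := by
    simp only [erd]
    rw [show Kinf n a (b + w + unitVec ρ, l) (b, κ) = Kinf n a (b + (w + unitVec ρ), l) (b, κ) by rw [add_assoc]]
    exact (calG_re_tendsto_Kinf n hn a ha (by norm_num) (b + (w + unitVec ρ)) b l κ).sub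
      (calG_re_tendsto_Kinf n hn a ha (by norm_num) (b + w) b l κ)
  have hsymm : ∀ x : Pt, Kinf n a (x, l) (b, κ) = Kinf n a (b, κ) (x, l) := fun x =>
    Kinf_symm n hn a ha (by norm_num) (x, l) (b, κ)
  rw [← hsymm (b + w + unitVec ρ), ← hsymm (b + w)]
  exact le_of_tendsto lim1.abs (hbox.mono fun t ht => key t ht)

/-! ## §2 The d1 profile at every pair, diagonal included -/

/-- [folklore] **(L1)-D1 IN PROFILE FORM: `|Ga n a x (y+e_ρ) κ l − Ga n a x y κ l| ≤ kG′·e^{−(δ∕n)‖y−x‖∞}∕nrm(y−x)³` AT EVERY PAIR** (`kG′ = A₁ + 2A_d`):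
off the diagonal §1 at `b = x`, `w = y − x` (`nrm = ‖·‖∞`); on it two flat entries (`abs_Ga_le_flatEntry`) and `nrm 0 = 1`, `e⁰ = 1`. -/
theorem exists_abs_Ga_diff_le_profile (h12 : B5.Prop12Printed (fam nOf hn1 MOf a ha)) (h126 : B5.Kernel126_127Printed (kfam nOf MOf)) :
    ∃ kG' δ : ℝ, 0 < δ ∧ 0 ≤ kG' ∧ ∀ (n : ℕ) [NeZero n] (x y : Pt) (κ l ρ : Fin 4),
      |Ga n a x (y + unitVec ρ) κ l - Ga n a x y κ l| ≤
        kG' * Real.exp (-(δ / n) * PoissonInterior.supNorm (d := 4) (y - x)) / nrm (d := 4) (y - x) ^ 3 := by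
  obtain ⟨δ, A₁, hδ, hA₁, hrow⟩ := Kinf_d1_row_of_prop12 a ha h12 h126
  set Ad : ℝ := cG0 4 + (woodburyDc 0 + ellD0 4 a) + ellD0 4 a with hAd_def
  have hAd : 0 ≤ Ad := (abs_nonneg _).trans (abs_Ga_le_flatEntry 1 ha 0 0 0 0)
  refine ⟨A₁ + 2 * Ad, δ, hδ, by positivity, fun n _ x y κ l ρ => ?_⟩
  by_cases hxy : y = x
  · subst hxy
    rw [sub_self, supNorm_zero, Nat.cast_zero, mul_zero, Real.exp_zero, mul_one]
    have e1 : nrm (d := 4) (0 : Pt) = 1 := by rw [nrm_eq_max, supNorm_zero, Nat.cast_zero]; exact max_eq_left zero_le_one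
    rw [e1, one_pow, div_one]
    calc |Ga n a y (y + unitVec ρ) κ l - Ga n a y y κ l| ≤ |Ga n a y (y + unitVec ρ) κ l| + |Ga n a y y κ l| := abs_sub _ _
      _ ≤ Ad + Ad := add_le_add (abs_Ga_le_flatEntry n ha _ _ κ l) (abs_Ga_le_flatEntry n ha _ _ κ l)
      _ ≤ A₁ + 2 * Ad := by linarith
  · have hw : y - x ≠ 0 := sub_ne_zero.mpr hxy
    have h1 := hrow n x (y - x) κ l hw ρ
    rw [add_sub_cancel] at h1
    rw [Ga_apply, Ga_apply, nrm_eq_supNorm_of_ne_zero (y - x) hw, ← supNorm_dyadic]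
    refine h1.trans ?_
    have hpos : (0 : ℝ) < (DyadicShell.supNorm (y - x) : ℝ) := by exact_mod_cast DyadicShell.supNorm_pos hw
    exact div_le_div_of_nonneg_right (mul_le_mul_of_nonneg_right (by linarith) (Real.exp_pos _).le) (by positivity)

/-- [folklore] **THE d1 PROFILE WITH THE DIFFERENCE ON THE FIRST SITE** (by `Ga_symm`: `Ga n a (x+e_ρ) y κ l = Ga n a y (x+e_ρ) l κ`):
`|Ga n a (x+e_ρ) y κ l − Ga n a x y κ l| ≤ kG′·e^{−(δ∕n)‖x−y‖∞}∕nrm(x−y)³`. -/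
theorem exists_abs_Ga_diff_left_le_profile (h12 : B5.Prop12Printed (fam nOf hn1 MOf a ha)) (h126 : B5.Kernel126_127Printed (kfam nOf MOf)) :
    ∃ kG' δ : ℝ, 0 < δ ∧ 0 ≤ kG' ∧ ∀ (n : ℕ) [NeZero n] (x y : Pt) (κ l ρ : Fin 4),
      |Ga n a (x + unitVec ρ) y κ l - Ga n a x y κ l| ≤
        kG' * Real.exp (-(δ / n) * PoissonInterior.supNorm (d := 4) (x - y)) / nrm (d := 4) (x - y) ^ 3 := by
  obtain ⟨kG', δ, hδ, hk, h⟩ := exists_abs_Ga_diff_le_profile a ha h12 h126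
  refine ⟨kG', δ, hδ, hk, fun n _ x y κ l ρ => ?_⟩
  rw [Ga_symm n a NeZero.one_le ha (x + unitVec ρ) y κ l, Ga_symm n a NeZero.one_le ha x y κ l]
  exact h n y x l κ ρ

/-- [folklore] **THE UNDAMPED READING** (the kit's `hA`∕`hK` shape, `a = 3`): `|Ga n a x (y+e_ρ) κ l − Ga n a x y κ l| ≤ kG′∕nrm(x−y)³`. -/
theorem exists_abs_Ga_diff_le_inv_cube (h12 : B5.Prop12Printed (fam nOf hn1 MOf a ha)) (h126 : B5.Kernel126_127Printed (kfam nOf MOf)) :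
    ∃ kG' : ℝ, 0 ≤ kG' ∧ ∀ (n : ℕ) [NeZero n] (x y : Pt) (κ l ρ : Fin 4),
      |Ga n a x (y + unitVec ρ) κ l - Ga n a x y κ l| ≤ kG' / nrm (d := 4) (x - y) ^ 3 := by
  obtain ⟨kG', δ, hδ, hk, h⟩ := exists_abs_Ga_diff_le_profile a ha h12 h126
  refine ⟨kG', hk, fun n _ x y κ l ρ => (h n x y κ l ρ).trans ?_⟩
  have hn : (0 : ℝ) < n := by exact_mod_cast Nat.pos_of_ne_zero (NeZero.ne n)
  have hnrm := nrm_pos (d := 4) (y - x)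
  rw [← nrm_neg (x - y), neg_sub]
  refine div_le_div_of_nonneg_right ?_ (by positivity)
  have hexp : Real.exp (-(δ / n) * PoissonInterior.supNorm (d := 4) (y - x)) ≤ 1 := by
    rw [Real.exp_le_one_iff]
    have : (0 : ℝ) ≤ δ / n * PoissonInterior.supNorm (d := 4) (y - x) := by positivity
    linarith
  calc kG' * Real.exp (-(δ / n) * PoissonInterior.supNorm (d := 4) (y - x)) ≤ kG' * 1 := mul_le_mul_of_nonneg_left hexp hk
    _ = kG' := mul_one _

/-! ## §3 The block-row mass of the d1 leg: `O(n)·e^{−δ′·dist}` («GN-L1-MASS-D1») -/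

/-- [folklore] **(L1)-MASS-D1: THE BLOCK-ROW |·|-MASS OF THE GLUON LEG's FIRST DIFFERENCES IS `O(n)` WITH BLOCK DECAY**, modulo
[B5, Prop. 1.2] ∧ [B5, (1.126)–(1.127)] BY NAME: one `C ≥ 0`, `δ′ > 0` with
`Σ_{t ∈ B (n−1) β} |Ga n a y (t+e_ρ) κ l − Ga n a y t κ l| ≤ C·n·e^{−δ′·dist (blk (n−1) y) β}` for every `n ≥ 1`, `y`, `β`, `κ`, `l`, `ρ`
(`δ′ = δ∕2`: half the rate is spent on the block decay through `dist_blk_ge` — `‖t−y‖∞ ≥ nD − (n−1)` —, the other half is summed by the HLS kit at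
`p = 3`: `Σ_t e^{−(δ∕2n)‖t−y‖}∕nrm(t−y)³ ≤ 1 + 216·(1 + 4n∕δ) ≤ (217 + 864∕δ)·n`). -/
theorem exists_sum_B_abs_Ga_diff_le (h12 : B5.Prop12Printed (fam nOf hn1 MOf a ha)) (h126 : B5.Kernel126_127Printed (kfam nOf MOf)) :
    ∃ C δ' : ℝ, 0 < δ' ∧ 0 ≤ C ∧ ∀ (n : ℕ) [NeZero n] (y β : Pt) (κ l ρ : Fin 4),
      ∑ t ∈ B (n - 1) β, |Ga n a y (t + unitVec ρ) κ l - Ga n a y t κ l| ≤ C * (n : ℝ) * Real.exp (-(δ' * dist (blk (n - 1) y) β)) := by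
  obtain ⟨kG', δ, hδ, hk, h⟩ := exists_abs_Ga_diff_le_profile a ha h12 h126
  refine ⟨kG' * Real.exp (δ / 2) * (217 + 864 / δ), δ / 2, by positivity, by positivity, fun n _ y β κ l ρ => ?_⟩
  have hn : (0 : ℝ) < n := by exact_mod_cast Nat.pos_of_ne_zero (NeZero.ne n)
  have hn1 : (1 : ℝ) ≤ n := by exact_mod_cast NeZero.one_le
  set m : ℕ := n - 1 with hm
  have hmn : ((m : ℝ) + 1) = n := GhostLeg.cast_pred_add_one n
  set D : ℝ := dist (blk m y) β with hD
  have hy : y ∈ B m (blk m y) := mem_B.2 rfl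
  -- per term: split the damping, half against the block distance
  have hterm : ∀ t ∈ B m β, |Ga n a y (t + unitVec ρ) κ l - Ga n a y t κ l| ≤
      kG' * Real.exp (δ / 2) * Real.exp (-(δ / 2 * D)) *
        (Real.exp (-(δ / 2 / n) * PoissonInterior.supNorm (d := 4) (t - y)) / nrm (d := 4) (t - y) ^ 3) := by
    intro t ht
    refine (h n y t κ l ρ).trans ?_
    have hnrm := nrm_pos (d := 4) (t - y)
    have hlow : (n : ℝ) * D - m ≤ (PoissonInterior.supNorm (d := 4) (t - y) : ℝ) := by
      have h1 := dist_blk_ge hy ht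
      rw [hmn, dist_eq_supNorm y t] at h1
      have e : DyadicShell.supNorm (y - t) = PoissonInterior.supNorm (d := 4) (t - y) := by
        rw [supNorm_dyadic, show y - t = -(t - y) by abel, supNorm_neg]
      rw [e] at h1
      exact h1
    have hmle : (m : ℝ) ≤ n := by linarith
    have hsplit : Real.exp (-(δ / n) * PoissonInterior.supNorm (d := 4) (t - y)) =
        Real.exp (-(δ / 2 / n) * PoissonInterior.supNorm (d := 4) (t - y)) * Real.exp (-(δ / 2 / n) * PoissonInterior.supNorm (d := 4) (t - y)) := by
      rw [← Real.exp_add]; congr 1; ring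
    have hhalf : Real.exp (-(δ / 2 / n) * PoissonInterior.supNorm (d := 4) (t - y)) ≤ Real.exp (δ / 2) * Real.exp (-(δ / 2 * D)) := by
      rw [← Real.exp_add]
      apply Real.exp_le_exp.mpr
      have h2 : δ / 2 / n * ((n : ℝ) * D - m) ≤ δ / 2 / n * PoissonInterior.supNorm (d := 4) (t - y) :=
        mul_le_mul_of_nonneg_left hlow (by positivity)
      have e2 : δ / 2 / n * ((n : ℝ) * D - m) = δ / 2 * D - δ / 2 * (m / n) := by field_simp
      have h3 : δ / 2 * ((m : ℝ) / n) ≤ δ / 2 := by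
        have : (m : ℝ) / n ≤ 1 := by rw [div_le_one hn]; exact hmle
        nlinarith
      nlinarith
    rw [hsplit]
    calc kG' * (Real.exp (-(δ / 2 / n) * PoissonInterior.supNorm (d := 4) (t - y)) *
          Real.exp (-(δ / 2 / n) * PoissonInterior.supNorm (d := 4) (t - y))) / nrm (d := 4) (t - y) ^ 3
        ≤ kG' * (Real.exp (δ / 2) * Real.exp (-(δ / 2 * D)) * Real.exp (-(δ / 2 / n) * PoissonInterior.supNorm (d := 4) (t - y))) /
            nrm (d := 4) (t - y) ^ 3 := by
          gcongr
      _ = _ := by ring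
  -- the remaining radial sum at `p = 3` by the kit
  have hkit := sum_exp_div_nrm_pow_le (d := 4) (by norm_num) (ε := δ / 2 / n) (by positivity) (p := 3) (by norm_num) (B m β) y
  have hkit' : ∑ t ∈ B m β, Real.exp (-(δ / 2 / n) * PoissonInterior.supNorm (d := 4) (t - y)) / nrm (d := 4) (t - y) ^ 3
      ≤ (217 + 864 / δ) * n := by
    refine hkit.trans ?_
    have e2 : (1 : ℝ) + 2 * (4 : ℕ) * 3 ^ (4 - 1) * (((4 - 1 - 3 : ℕ).factorial : ℝ) * (2 / (δ / 2 / n)) ^ (4 - 1 - 3) * (1 + 2 / (δ / 2 / n)))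
        = 217 + 864 / δ * n := by
      rw [show (4 : ℕ) - 1 - 3 = 0 by norm_num, Nat.factorial_zero, pow_zero, Nat.cast_one, one_mul]
      field_simp
      ring
    rw [e2]
    have e3 : (217 + 864 / δ) * (n : ℝ) = 217 * n + 864 / δ * n := by ring
    rw [e3]
    linarith
  calc ∑ t ∈ B m β, |Ga n a y (t + unitVec ρ) κ l - Ga n a y t κ l|
      ≤ ∑ t ∈ B m β, kG' * Real.exp (δ / 2) * Real.exp (-(δ / 2 * D)) *
          (Real.exp (-(δ / 2 / n) * PoissonInterior.supNorm (d := 4) (t - y)) / nrm (d := 4) (t - y) ^ 3) := Finset.sum_le_sum hterm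
    _ = kG' * Real.exp (δ / 2) * Real.exp (-(δ / 2 * D)) *
          ∑ t ∈ B m β, Real.exp (-(δ / 2 / n) * PoissonInterior.supNorm (d := 4) (t - y)) / nrm (d := 4) (t - y) ^ 3 := by
        rw [Finset.mul_sum]
    _ ≤ kG' * Real.exp (δ / 2) * Real.exp (-(δ / 2 * D)) * ((217 + 864 / δ) * n) :=
        mul_le_mul_of_nonneg_left hkit' (by positivity)
    _ = kG' * Real.exp (δ / 2) * (217 + 864 / δ) * (n : ℝ) * Real.exp (-(δ / 2 * D)) := by ring

end Summit.QuantumFields.BalabanUV.Beta.D1BFx.GluonLegProfileD1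

end
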